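import Literature.NumberTheory.Automorphic.UnitaryGroupGeometricSide
import Literature.NumberTheory.Automorphic.GLnIwasawaIntegration
import Literature.MeasureTheory.Group.InvariantQuotientNormalized
import HarnessLib

/-!
# The geometric side of the trace formula with the PRINTED VOLUMES, for an adelic group datum with trivial split centre and
# compact quotient, and for the anisotropic unitary group `U(H)(𝔸_{L⁺})`:
# `∫_X K_Φ(x, x) dμ = κ · c_μ · Σ'_{[γ]} vol(G_γ(𝔸) ⧸ G_γ(K)) ∫_{G(𝔸) ⧸ G_γ(𝔸)} Φ(y γ y⁻¹) d(ν/ν_γ)(y)`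
(Gelbart, *Automorphic forms on adele groups* (1975), (9.13) and Remark 9.23 (p. 140): `tr R₀(φ) = Σ_{[γ]} vol(Γ(γ)\G_γ)
∫_{G_γ\G} φ(x⁻¹γx) dx`, `meas(Z_∞⁺ G(γ)_ℚ \ G(γ)_𝔸)`; Rogawski (1990), §14.5 pp. 237–238 (print): `J_{G′}(f′) = Σ_γ a_γ Φ(γ, f′)`,
`a_γ = ε⁻¹ m(Z𝐆_γ \ 𝐆_γ)`; Deitmar–Echterhoff (2014), Thm. 9.3.2 / Lemma 9.3.3)

Topic `NumberTheory/Automorphic`; THEOREMS ONLY (no definition, no named fact, no instance).  ★ `UnitaryGroupGeometricSide`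
(`AdelicGroupData.integral_quotientKernel_diag_eq_mul_tsum_of_center'_eq_bot`, `…_cmDatum`) proves the orbital expansion of the kernel
diagonal with UNSPECIFIED constants `d_c ∈ (0, ∞)` and UNSPECIFIED invariant measures `μ_c` on the orbit spaces (it consumes the
existential ★ `exists_lintegral_conjTsum_eq_tsum`), so that the orbital terms of ★ `IsOrbitalTerms` / the (O-H) currency carry opaque
weights.  This file proves the SAME expansion with the printed constants, consuming instead the tree's printed-volume unfolding
★ `Literature.MeasureTheory.Group.lintegral_conjTsum_eq_mul_tsum_covol_mul` (the route of ★ `QuaternionUnitsTraceNormalized` for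
`D^×`):

* `AdelicGroupData.lintegral_conjTsum_eq_mul_tsum_covol_mul_of_center'_eq_bot` — `[0, ∞]`-valued: for `A_G = ⊥`, `G(K)` discrete,
  `X = G(𝔸_K) ⧸ G(K)` compact, `μ` invariant on `X`, Haar measures `ν` on `G(𝔸_K)`, `ρ` on the (discrete) `G(K)`, and for EVERY
  conjugacy class `c` of `G(K)` a Haar measure `ν_c` on the adelic centraliser `G_c = C_{G(𝔸_K)}(γ_c)` (`γ_c = out c`; two-sided and
  inversion invariant — automatic: `G_c` is unimodular, ★ `isMulRightInvariant_centralizer_of_center'_eq_bot` and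
  `isInvInvariant_centralizer_of_center'_eq_bot` below),
  `∫_X Σ'_{γ ∈ G(K)} F(x γ x⁻¹) dμ = c_μ · Σ'_c vol(G_c ⧸ G(K)_c) · ∫_{G(𝔸_K) ⧸ G_c} F(y γ_c y⁻¹) d(ν/ν_c)` for Borel `F ≥ 0`, where
  `c_μ = unfoldingConstant`, `ν/ν_c = quotientMeasure G_c ν_c ν` (Weil constant one) and `vol(G_c ⧸ G(K)_c)` is the total mass of
  `quotientMeasure (G(K)_c ⊓ G_c) ρ_{F,c} ν_c` for the restriction `ρ_{F,c}` of `ρ` to `G(K)_c = G(K) ∩ G_c` (Gelbart's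
  `meas(G(γ)_ℚ \ G(γ)_𝔸)`);
* `AdelicGroupData.exists_restricted_haar_of_center'_eq_bot` — the restricted measures `ρ_{H,c}`, `ρ_{F,c}` exist (Haar, inversion
  invariant, s-finite) — non-vacuity of the parameters;
* `AdelicGroupData.integral_quotientKernel_diag_eq_mul_tsum_covol_of_center'_eq_bot` — the `ℂ`-valued geometric side of the kernel
  diagonal for `Φ ∈ C_c(G(𝔸_K))`: absolute convergence and `∫_X K_Φ(x, x) dμ = κ Σ'_c d_c ∫ Φ(y γ_c y⁻¹) d(ν/ν_c)` with
  `d_c = c_μ · vol(G_c ⧸ G(K)_c)` EXPLICIT and `κ > 0` the scalar `ρ = κ · counting`;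
* `UnitaryGroup.integral_quotientKernel_diag_eq_mul_tsum_covol_cmDatum` — the specialisation to the anisotropic unitary group
  `U(H)(𝔸_{L⁺})` (★ `cmDatum`: `A_G = ⊥` by `rfl`, discrete rational points, compact quotient by Godement, unimodular).

WHY.  The floor-0 comparison kit's β-socket and the road (M-C) «measure coherence» (F0P3a RULING #30 (2)–(3), #31) need the weights of
the orbital expansion at the regular classes to BE covolumes `vol(G_γ(𝔸) ⧸ G_γ(K))` of explicit torus measures, so that their constancy
on stable classes follows from covolume transport (★ `quotientMeasure_univ_eq_of_mulEquiv`) once the torus measures are canonical.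

## References
* S. Gelbart, *Automorphic forms on adele groups*, Ann. of Math. Studies 83 (1975), (9.13), Remark 9.23 [Gelbart1975].
* J. D. Rogawski, *Automorphic Representations of Unitary Groups in Three Variables*, Ann. of Math. Stud. 123 (1990), §14.5
  pp. 237–238 (print) [Rogawski1990].
* A. Deitmar, S. Echterhoff, *Principles of Harmonic Analysis*, 2nd ed. (2014), Thm. 9.3.2, Lemma 9.3.3 [DeitmarEchterhoff2014].
-/

noncomputable section

open MeasureTheory Measure Set Filter Topology NumberField CompactlySupported
open Literature.MeasureTheory.Group
open scoped ENNReal NNReal Pointwise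

namespace Literature.NumberTheory.Automorphic

universe u

/-- The centraliser of an element of a Hausdorff topological group is closed. [folklore] -/
private theorem isClosed_centralizer_singleton₃ {G : Type*} [Group G] [TopologicalSpace G]
    [IsTopologicalGroup G] [T2Space G] (γ : G) :
    IsClosed ((Subgroup.centralizer ({γ} : Set G) : Subgroup G) : Set G) := by
  have h : ((Subgroup.centralizer ({γ} : Set G) : Subgroup G) : Set G) = {g : G | γ * g = g * γ} := by
    ext g
    rw [SetLike.mem_coe, Subgroup.mem_centralizer_iff]
    simp only [Set.mem_singleton_iff, forall_eq, Set.mem_setOf_eq]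
  rw [h]
  exact isClosed_eq (continuous_const.mul continuous_id) (continuous_id.mul continuous_const)

namespace AdelicGroupData

variable {K : Type} [Field K] [NumberField K] (𝒢 : AdelicGroupData.{u} K)

/-- For `A_G = ⊥` the trivial homomorphism is a continuous central retraction. [folklore] -/
private theorem centralRetraction_one' (hc : 𝒢.center' = ⊥) :
    Continuous (1 : 𝒢.Adelic →* 𝒢.Adelic) ∧ (∀ g, (1 : 𝒢.Adelic →* 𝒢.Adelic) g ∈ 𝒢.center') ∧
      (∀ a ∈ 𝒢.center', (1 : 𝒢.Adelic →* 𝒢.Adelic) a = a) ∧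
      ∀ γ ∈ 𝒢.arithmeticSubgroup, (1 : 𝒢.Adelic →* 𝒢.Adelic) γ = 1 := by
  refine ⟨continuous_const, fun g => ?_, fun a ha => ?_, fun γ _ => rfl⟩
  · rw [MonoidHom.one_apply]
    exact one_mem _
  · rw [hc, Subgroup.mem_bot] at ha
    rw [ha, MonoidHom.one_apply]

attribute [local instance] measurableSpaceQuotientForm borelSpaceQuotientForm
  smulInvariantMeasureQuotientForm isFiniteMeasureOnCompactsQuotientForm isFiniteMeasureQuotientForm

variable [LocallyCompactSpace 𝒢.Adelic] [SecondCountableTopology 𝒢.Adelic] [T2Space 𝒢.Adelic]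
  [MeasurableSpace 𝒢.Adelic] [BorelSpace 𝒢.Adelic]
  [∀ γ : 𝒢.Adelic, MeasurableSpace (𝒢.Adelic ⧸ Subgroup.centralizer ({γ} : Set 𝒢.Adelic))]
  [∀ γ : 𝒢.Adelic, BorelSpace (𝒢.Adelic ⧸ Subgroup.centralizer ({γ} : Set 𝒢.Adelic))]
  [∀ γ : 𝒢.Adelic, MeasurableSpace (↥(Subgroup.centralizer ({γ} : Set 𝒢.Adelic)) ⧸
    (𝒢.quotientSubgroup ⊓ Subgroup.centralizer ({γ} : Set 𝒢.Adelic)).subgroupOf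
      (Subgroup.centralizer ({γ} : Set 𝒢.Adelic)))]
  [∀ γ : 𝒢.Adelic, BorelSpace (↥(Subgroup.centralizer ({γ} : Set 𝒢.Adelic)) ⧸
    (𝒢.quotientSubgroup ⊓ Subgroup.centralizer ({γ} : Set 𝒢.Adelic)).subgroupOf
      (Subgroup.centralizer ({γ} : Set 𝒢.Adelic)))]

omit [∀ γ : 𝒢.Adelic, MeasurableSpace (𝒢.Adelic ⧸ Subgroup.centralizer ({γ} : Set 𝒢.Adelic))]
  [∀ γ : 𝒢.Adelic, BorelSpace (𝒢.Adelic ⧸ Subgroup.centralizer ({γ} : Set 𝒢.Adelic))]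
  [∀ γ : 𝒢.Adelic, MeasurableSpace (↥(Subgroup.centralizer ({γ} : Set 𝒢.Adelic)) ⧸
    (𝒢.quotientSubgroup ⊓ Subgroup.centralizer ({γ} : Set 𝒢.Adelic)).subgroupOf
      (Subgroup.centralizer ({γ} : Set 𝒢.Adelic)))]
  [∀ γ : 𝒢.Adelic, BorelSpace (↥(Subgroup.centralizer ({γ} : Set 𝒢.Adelic)) ⧸
    (𝒢.quotientSubgroup ⊓ Subgroup.centralizer ({γ} : Set 𝒢.Adelic)).subgroupOf
      (Subgroup.centralizer ({γ} : Set 𝒢.Adelic)))] in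
/-- **The restricted Haar measures exist** (non-vacuity of the parameters `ρ_{H,c}`, `ρ_{F,c}` below): for `A_G = ⊥`, `G(K)` discrete
and `ρ` a Haar measure on `A_G · G(K) = G(K)`, the restriction `ρ_{H,c} = ρ|_{G(K)_c}` to `G(K)_c = G(K) ∩ C_{G(𝔸_K)}(γ_c)` (relatively
open in the discrete `G(K)`) is a Haar measure, inversion invariant and s-finite, and so is its transport `ρ_{F,c}` to
`G(K)_c ≤ G_c = C_{G(𝔸_K)}(γ_c)` (the measures on `G(γ)_ℚ` of Gelbart's `meas(Z_∞⁺ G(γ)_ℚ \\ G(γ)_𝔸)`; Deitmar–Echterhoff (2014),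
Thm. 9.3.2: counting measure on the lattice `Γ_γ`). [cite: DeitmarEchterhoff2014, Thm. 9.3.2] -/
theorem exists_restricted_haar_of_center'_eq_bot (hc : 𝒢.center' = ⊥) (hdisc : 𝒢.IsDiscreteRational)
    [CompactSpace 𝒢.automorphicQuotient] [hH : IsClosed (𝒢.quotientSubgroup : Set 𝒢.Adelic)]
    (ρ : Measure 𝒢.quotientSubgroup) [ρ.IsHaarMeasure] [SFinite ρ] :
    ∃ (ρH : ∀ c : ConjClasses 𝒢.arithmeticSubgroup, Measure ↥(𝒢.quotientSubgroup ⊓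
        Subgroup.centralizer ({((Quotient.out c : 𝒢.arithmeticSubgroup) : 𝒢.Adelic)} : Set 𝒢.Adelic)))
      (ρF : ∀ c : ConjClasses 𝒢.arithmeticSubgroup, Measure ↥((𝒢.quotientSubgroup ⊓
        Subgroup.centralizer ({((Quotient.out c : 𝒢.arithmeticSubgroup) : 𝒢.Adelic)} : Set 𝒢.Adelic)).subgroupOf
          (Subgroup.centralizer ({((Quotient.out c : 𝒢.arithmeticSubgroup) : 𝒢.Adelic)} : Set 𝒢.Adelic)))),
      (∀ c, IsHaarMeasure (ρH c)) ∧ (∀ c, (ρH c).IsInvInvariant) ∧ (∀ c, SFinite (ρH c)) ∧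
      (∀ c, IsHaarMeasure (ρF c)) ∧ (∀ c, (ρF c).IsInvInvariant) ∧ (∀ c, SFinite (ρF c)) ∧
      (∀ c, ρH c = ρ.comap (Subgroup.inclusion inf_le_left)) ∧
      (∀ c, ρF c = Measure.map (Subgroup.subgroupOfEquivOfLe inf_le_right).symm (ρH c)) := by
  obtain ⟨hθc, hθA, hθa, hθγ⟩ := 𝒢.centralRetraction_one' hc
  haveI : ρ.IsMulRightInvariant := 𝒢.isMulRightInvariant_of_centralRetraction hdisc 1 hθc hθA hθa hθγ ρ
  haveI : ρ.IsInvInvariant := isInvInvariant_of_isMulRightInvariant ρ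
  haveI hCcl : ∀ γ : 𝒢.Adelic, IsClosed ((Subgroup.centralizer ({γ} : Set 𝒢.Adelic) : Subgroup 𝒢.Adelic) :
      Set 𝒢.Adelic) := fun γ => isClosed_centralizer_singleton₃ γ
  have hHcl : ∀ c : ConjClasses 𝒢.arithmeticSubgroup,
      IsClosed (((𝒢.quotientSubgroup ⊓ Subgroup.centralizer
        ({((Quotient.out c : 𝒢.arithmeticSubgroup) : 𝒢.Adelic)} : Set 𝒢.Adelic)) : Subgroup 𝒢.Adelic) :
          Set 𝒢.Adelic) := fun c => hH.inter (hCcl _)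
  have hopen : ∀ c : ConjClasses 𝒢.arithmeticSubgroup,
      IsOpen ((((𝒢.quotientSubgroup ⊓ Subgroup.centralizer
        ({((Quotient.out c : 𝒢.arithmeticSubgroup) : 𝒢.Adelic)} : Set 𝒢.Adelic)).subgroupOf 𝒢.quotientSubgroup :
          Subgroup 𝒢.quotientSubgroup)) : Set 𝒢.quotientSubgroup) := fun c =>
    AdelicGroupData.isOpen_subgroupOf_quotientSubgroup_of_center'_le 𝒢 hdisc 1 hθc hθA hθa hθγ
      (AdelicGroupData.center'_le_inf_centralizer 𝒢 _)
  set ρH : ∀ c : ConjClasses 𝒢.arithmeticSubgroup, Measure ↥(𝒢.quotientSubgroup ⊓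
      Subgroup.centralizer ({((Quotient.out c : 𝒢.arithmeticSubgroup) : 𝒢.Adelic)} : Set 𝒢.Adelic)) :=
    fun c => ρ.comap (Subgroup.inclusion inf_le_left) with hρH
  haveI hHa : ∀ c, IsHaarMeasure (ρH c) := fun c =>
    isHaarMeasure_comap_subgroupInclusion _ _ inf_le_left (hopen c) ρ
  haveI hHi : ∀ c, (ρH c).IsInvInvariant := fun c =>
    isInvInvariant_comap (Subgroup.inclusion inf_le_left)
      (measurableEmbedding_subgroupInclusion _ _ inf_le_left (hHcl c)) ρ
  haveI hHs : ∀ c, SFinite (ρH c) := fun c => inferInstance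
  set ρF : ∀ c : ConjClasses 𝒢.arithmeticSubgroup, Measure ↥((𝒢.quotientSubgroup ⊓
      Subgroup.centralizer ({((Quotient.out c : 𝒢.arithmeticSubgroup) : 𝒢.Adelic)} : Set 𝒢.Adelic)).subgroupOf
        (Subgroup.centralizer ({((Quotient.out c : 𝒢.arithmeticSubgroup) : 𝒢.Adelic)} : Set 𝒢.Adelic))) :=
    fun c => Measure.map (Subgroup.subgroupOfEquivOfLe (inf_le_right :
      𝒢.quotientSubgroup ⊓ Subgroup.centralizer
        ({((Quotient.out c : 𝒢.arithmeticSubgroup) : 𝒢.Adelic)} : Set 𝒢.Adelic) ≤ _)).symm (ρH c) with hρF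
  have hFa : ∀ c, IsHaarMeasure (ρF c) := fun c =>
    MulEquiv.isHaarMeasure_map (ρH c) _ (continuous_subgroupOfEquivOfLe_symm _ _ inf_le_right)
      (continuous_subgroupOfEquivOfLe _ _ inf_le_right)
  have hFi : ∀ c, (ρF c).IsInvInvariant := fun c =>
    isInvInvariant_map_mulEquiv _ (continuous_subgroupOfEquivOfLe_symm _ _ inf_le_right).measurable (ρH c)
  have hFs : ∀ c, SFinite (ρF c) := fun c => inferInstance
  exact ⟨ρH, ρF, hHa, hHi, hHs, hFa, hFi, hFs, fun c => rfl, fun c => rfl⟩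

omit [∀ γ : 𝒢.Adelic, MeasurableSpace (𝒢.Adelic ⧸ Subgroup.centralizer ({γ} : Set 𝒢.Adelic))]
  [∀ γ : 𝒢.Adelic, BorelSpace (𝒢.Adelic ⧸ Subgroup.centralizer ({γ} : Set 𝒢.Adelic))]
  [∀ γ : 𝒢.Adelic, MeasurableSpace (↥(Subgroup.centralizer ({γ} : Set 𝒢.Adelic)) ⧸
    (𝒢.quotientSubgroup ⊓ Subgroup.centralizer ({γ} : Set 𝒢.Adelic)).subgroupOf
      (Subgroup.centralizer ({γ} : Set 𝒢.Adelic)))]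
  [∀ γ : 𝒢.Adelic, BorelSpace (↥(Subgroup.centralizer ({γ} : Set 𝒢.Adelic)) ⧸
    (𝒢.quotientSubgroup ⊓ Subgroup.centralizer ({γ} : Set 𝒢.Adelic)).subgroupOf
      (Subgroup.centralizer ({γ} : Set 𝒢.Adelic)))] in
/-- **Every Haar measure on an adelic centraliser `G_γ = C_{G(𝔸_K)}(γ)` of a rational `γ` is inversion invariant** (`A_G = ⊥`,
`G(K)` discrete, compact quotient): `G_γ` is unimodular (★ `isMulRightInvariant_centralizer_of_center'_eq_bot`, Deitmar–Echterhoff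
(2014), Lemma 9.3.3) and a Haar measure of a second countable unimodular group is inversion invariant
(★ `isInvInvariant_of_isMulRightInvariant`). Discharges the instance hypothesis on `ν_c` below. [cite: DeitmarEchterhoff2014, Lemma 9.3.3] -/
theorem isInvInvariant_centralizer_of_center'_eq_bot (hc : 𝒢.center' = ⊥) (hdisc : 𝒢.IsDiscreteRational)
    [CompactSpace 𝒢.automorphicQuotient] {γ : 𝒢.Adelic} (hγ : γ ∈ 𝒢.arithmeticSubgroup)
    (νZ : Measure ↥(Subgroup.centralizer ({γ} : Set 𝒢.Adelic))) [IsHaarMeasure νZ] : νZ.IsInvInvariant := by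
  have hZc : IsClosed ((Subgroup.centralizer ({γ} : Set 𝒢.Adelic) : Subgroup 𝒢.Adelic) : Set 𝒢.Adelic) :=
    isClosed_centralizer_singleton₃ γ
  haveI : LocallyCompactSpace ↥(Subgroup.centralizer ({γ} : Set 𝒢.Adelic)) :=
    hZc.isClosedEmbedding_subtypeVal.locallyCompactSpace
  haveI : SecondCountableTopology ↥(Subgroup.centralizer ({γ} : Set 𝒢.Adelic)) :=
    TopologicalSpace.Subtype.secondCountableTopology _
  haveI := 𝒢.isMulRightInvariant_centralizer_of_center'_eq_bot hc hdisc hγ νZ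
  exact isInvInvariant_of_isMulRightInvariant νZ

/-- **The `[0, ∞]`-valued geometric side with the printed volumes** (Gelbart (1975), (9.13) and Remark 9.23; Deitmar–Echterhoff
(2014), Thm. 9.3.2) for an adelic group datum `𝒢` with `A_G = ⊥`, `G(K)` discrete and `X = G(𝔸_K) ⧸ G(K)` compact: `μ` an invariant
measure on `X` (finite on compacts, non-zero), Haar measures `ν` on `G(𝔸_K)` and `ρ` on `A_G · G(K) = G(K)`; for every conjugacy
class `c` of `G(K)`, `γ_c = out c`, `G_c = C_{G(𝔸_K)}(γ_c)` (closed; UNIMODULAR by ★ `isMulRightInvariant_centralizer_of_center'_eq_bot`,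
so ANY Haar measure `ν_c` on it is two-sided and inversion invariant), `H_c = G(K) ∩ G_c`, `ρ_{H,c} = ρ|_{H_c}`, `ρ_{F,c}` its transport to
`H_c ≤ G_c` (these exist: `exists_restricted_haar_of_center'_eq_bot`).  Then for every Borel `F : G(𝔸_K) → [0, ∞]`

  `∫_X Σ'_{γ ∈ G(K)} F(x̃ γ x̃⁻¹) dμ(x) = c_μ · Σ'_c vol(G_c ⧸ H_c) · ∫_{G(𝔸_K) ⧸ G_c} F(y γ_c y⁻¹) d(ν/ν_c)(y)`

with `c_μ = unfoldingConstant (A_G·G(K)) ρ μ ν`, `ν/ν_c = quotientMeasure G_c ν_c ν` (Weil constant one) and `vol(G_c ⧸ H_c)` the total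
mass of `quotientMeasure (H_c ⊓ G_c) ρ_{F,c} ν_c` — Gelbart's `meas(G(γ)_ℚ \ G(γ)_𝔸)`. [cite: Gelbart1975, (9.13) and Remark 9.23] -/
theorem lintegral_conjTsum_eq_mul_tsum_covol_mul_of_center'_eq_bot (hc : 𝒢.center' = ⊥)
    (hdisc : 𝒢.IsDiscreteRational) [CompactSpace 𝒢.automorphicQuotient]
    [hH : IsClosed (𝒢.quotientSubgroup : Set 𝒢.Adelic)]
    [hCcl : ∀ γ : 𝒢.Adelic, IsClosed ((Subgroup.centralizer ({γ} : Set 𝒢.Adelic) : Subgroup 𝒢.Adelic) : Set 𝒢.Adelic)]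
    (μ : Measure 𝒢.automorphicQuotient) [𝒢.IsAutomorphicMeasure μ]
    (ν : Measure 𝒢.Adelic) [IsHaarMeasure ν] [ν.IsMulRightInvariant]
    (ρ : Measure 𝒢.quotientSubgroup) [ρ.IsHaarMeasure] [SFinite ρ]
    (ρH : ∀ c : ConjClasses 𝒢.arithmeticSubgroup, Measure ↥(𝒢.quotientSubgroup ⊓
      Subgroup.centralizer ({((Quotient.out c : 𝒢.arithmeticSubgroup) : 𝒢.Adelic)} : Set 𝒢.Adelic)))
    [∀ c, IsHaarMeasure (ρH c)] [∀ c, (ρH c).IsInvInvariant] [∀ c, SFinite (ρH c)]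
    (ρF : ∀ c : ConjClasses 𝒢.arithmeticSubgroup, Measure ↥((𝒢.quotientSubgroup ⊓
      Subgroup.centralizer ({((Quotient.out c : 𝒢.arithmeticSubgroup) : 𝒢.Adelic)} : Set 𝒢.Adelic)).subgroupOf
        (Subgroup.centralizer ({((Quotient.out c : 𝒢.arithmeticSubgroup) : 𝒢.Adelic)} : Set 𝒢.Adelic))))
    [∀ c, IsHaarMeasure (ρF c)] [∀ c, (ρF c).IsInvInvariant] [∀ c, SFinite (ρF c)]
    (νC : ∀ c : ConjClasses 𝒢.arithmeticSubgroup, Measure ↥(Subgroup.centralizer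
      ({((Quotient.out c : 𝒢.arithmeticSubgroup) : 𝒢.Adelic)} : Set 𝒢.Adelic)))
    [∀ c, IsHaarMeasure (νC c)] [∀ c, (νC c).IsMulRightInvariant] [∀ c, (νC c).IsInvInvariant] [∀ c, SFinite (νC c)]
    (hρH : ∀ c, ρH c = ρ.comap (Subgroup.inclusion inf_le_left))
    (hρF : ∀ c, ρF c = Measure.map (Subgroup.subgroupOfEquivOfLe inf_le_right).symm (ρH c))
    {F : 𝒢.Adelic → ℝ≥0∞} (hF : Measurable F) :
    ∫⁻ x, conjTsum 𝒢.quotientSubgroup (𝒢.arithmeticSubgroup : Set 𝒢.Adelic)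
        (AdelicGroupData.conj_mem_arithmeticSubgroup 𝒢) F x ∂μ =
      unfoldingConstant 𝒢.quotientSubgroup ρ μ ν *
        ∑' c : ConjClasses 𝒢.arithmeticSubgroup,
          quotientMeasure ((𝒢.quotientSubgroup ⊓ Subgroup.centralizer
              ({((Quotient.out c : 𝒢.arithmeticSubgroup) : 𝒢.Adelic)} : Set 𝒢.Adelic)).subgroupOf
              (Subgroup.centralizer ({((Quotient.out c : 𝒢.arithmeticSubgroup) : 𝒢.Adelic)} : Set 𝒢.Adelic)))
              (ρF c) (isClosed_subgroupOf _ _ (hH.inter (hCcl _))) (νC c) Set.univ *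
            ∫⁻ y, descConj ((Quotient.out c : 𝒢.arithmeticSubgroup) : 𝒢.Adelic)
              (Subgroup.centralizer ({((Quotient.out c : 𝒢.arithmeticSubgroup) : 𝒢.Adelic)} : Set 𝒢.Adelic))
              (fun _ hg => Subgroup.mem_centralizer_singleton_iff.1 hg) F y
              ∂quotientMeasure (Subgroup.centralizer
                ({((Quotient.out c : 𝒢.arithmeticSubgroup) : 𝒢.Adelic)} : Set 𝒢.Adelic)) (νC c) (hCcl _) ν := by
  classical
  haveI : DiscreteTopology 𝒢.arithmeticSubgroup := hdisc
  haveI : Countable 𝒢.arithmeticSubgroup := DiscreteSubgroup.countable_of_discrete _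
  obtain ⟨hθc, hθA, hθa, hθγ⟩ := 𝒢.centralRetraction_one' hc
  have hrep : ∀ c : ConjClasses 𝒢.arithmeticSubgroup,
      ConjClasses.mk (Quotient.out c : 𝒢.arithmeticSubgroup) = c := fun c => by
    rw [← ConjClasses.quotient_mk_eq_mk]; exact Quotient.out_eq c
  haveI : ∀ c : ConjClasses 𝒢.arithmeticSubgroup,
      IsClosed (((𝒢.quotientSubgroup ⊓ Subgroup.centralizer
        ({((Quotient.out c : 𝒢.arithmeticSubgroup) : 𝒢.Adelic)} : Set 𝒢.Adelic)) : Subgroup 𝒢.Adelic) :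
          Set 𝒢.Adelic) := fun c => hH.inter (hCcl _)
  haveI : ∀ c : ConjClasses 𝒢.arithmeticSubgroup,
      CompactSpace (↥(Subgroup.centralizer ({((Quotient.out c : 𝒢.arithmeticSubgroup) : 𝒢.Adelic)} : Set 𝒢.Adelic)) ⧸
        (𝒢.quotientSubgroup ⊓ Subgroup.centralizer ({((Quotient.out c : 𝒢.arithmeticSubgroup) : 𝒢.Adelic)} :
          Set 𝒢.Adelic)).subgroupOf (Subgroup.centralizer
            ({((Quotient.out c : 𝒢.arithmeticSubgroup) : 𝒢.Adelic)} : Set 𝒢.Adelic))) :=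
    fun c => 𝒢.compactSpace_centralizer_quotient hdisc (Quotient.out c).2
  exact Literature.MeasureTheory.Group.lintegral_conjTsum_eq_mul_tsum_covol_mul
    𝒢.arithmeticSubgroup 𝒢.quotientSubgroup 𝒢.arithmeticSubgroup_le_quotientSubgroup
    (AdelicGroupData.exists_inv_mul_mem_centralizer_quotientSubgroup 𝒢)
    (fun c => Quotient.out c) hrep
    (fun c => 𝒢.quotientSubgroup ⊓ Subgroup.centralizer
      ({((Quotient.out c : 𝒢.arithmeticSubgroup) : 𝒢.Adelic)} : Set 𝒢.Adelic))
    (fun c => Subgroup.centralizer ({((Quotient.out c : 𝒢.arithmeticSubgroup) : 𝒢.Adelic)} : Set 𝒢.Adelic))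
    (fun c g => mem_inf_centralizer_singleton_iff _ _ _) (fun c => inf_le_right)
    (fun c => fun _ hg => Subgroup.mem_centralizer_singleton_iff.1 hg) μ ν ρ ρH ρF νC
    (fun c => AdelicGroupData.isOpen_subgroupOf_quotientSubgroup_of_center'_le 𝒢 hdisc 1 hθc hθA hθa hθγ
      (AdelicGroupData.center'_le_inf_centralizer 𝒢 _))
    (AdelicGroupData.IsAutomorphicMeasure.ne_zero 𝒢 μ) hρH hρF hF

/-- **The geometric side of the kernel diagonal with the printed volumes** (Gelbart (1975), (9.13) and Remark 9.23): in the setting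
of `lintegral_conjTsum_eq_mul_tsum_covol_mul_of_center'_eq_bot` (with `ρ` also right invariant and s-finite, the binders under which
the kernel ★ `quotientKernel` is stated), there is `κ > 0` (the scalar `ρ = κ · counting` of the Haar measure of the discrete `G(K)`)
such that for every `Φ ∈ C_c(G(𝔸_K))`: every orbital integrand `y ↦ Φ(y γ_c y⁻¹)` is `ν/ν_c`-integrable,
`Σ_c d_c ∫ |Φ(y γ_c y⁻¹)| d(ν/ν_c) < ∞`, and

  `∫_X K_Φ(x, x) dμ(x) = κ · Σ'_c d_c · ∫_{G(𝔸_K) ⧸ G_c} Φ(y γ_c y⁻¹) d(ν/ν_c)(y)`,  `d_c = c_μ · vol(G_c ⧸ H_c)` EXPLICIT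

(`c_μ = unfoldingConstant`, `vol(G_c ⧸ H_c) = quotientMeasure (H_c ⊓ G_c) ρ_{F,c} ν_c (⊤) ∈ (0, ∞)`).  This is
★ `integral_quotientKernel_diag_eq_mul_tsum_of_center'_eq_bot` with its constants identified. [cite: Gelbart1975, (9.13) and Remark 9.23] -/
theorem integral_quotientKernel_diag_eq_mul_tsum_covol_of_center'_eq_bot (hc : 𝒢.center' = ⊥)
    (hdisc : 𝒢.IsDiscreteRational) [CompactSpace 𝒢.automorphicQuotient]
    [hH : IsClosed (𝒢.quotientSubgroup : Set 𝒢.Adelic)]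
    [hCcl : ∀ γ : 𝒢.Adelic, IsClosed ((Subgroup.centralizer ({γ} : Set 𝒢.Adelic) : Subgroup 𝒢.Adelic) : Set 𝒢.Adelic)]
    (μ : Measure 𝒢.automorphicQuotient) [𝒢.IsAutomorphicMeasure μ]
    (ν : Measure 𝒢.Adelic) [IsHaarMeasure ν] [ν.IsMulRightInvariant]
    (ρ : Measure 𝒢.quotientSubgroup) [ρ.IsHaarMeasure] [ρ.IsMulRightInvariant] [SFinite ρ]
    (ρH : ∀ c : ConjClasses 𝒢.arithmeticSubgroup, Measure ↥(𝒢.quotientSubgroup ⊓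
      Subgroup.centralizer ({((Quotient.out c : 𝒢.arithmeticSubgroup) : 𝒢.Adelic)} : Set 𝒢.Adelic)))
    [∀ c, IsHaarMeasure (ρH c)] [∀ c, (ρH c).IsInvInvariant] [∀ c, SFinite (ρH c)]
    (ρF : ∀ c : ConjClasses 𝒢.arithmeticSubgroup, Measure ↥((𝒢.quotientSubgroup ⊓
      Subgroup.centralizer ({((Quotient.out c : 𝒢.arithmeticSubgroup) : 𝒢.Adelic)} : Set 𝒢.Adelic)).subgroupOf
        (Subgroup.centralizer ({((Quotient.out c : 𝒢.arithmeticSubgroup) : 𝒢.Adelic)} : Set 𝒢.Adelic))))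
    [∀ c, IsHaarMeasure (ρF c)] [∀ c, (ρF c).IsInvInvariant] [∀ c, SFinite (ρF c)]
    (νC : ∀ c : ConjClasses 𝒢.arithmeticSubgroup, Measure ↥(Subgroup.centralizer
      ({((Quotient.out c : 𝒢.arithmeticSubgroup) : 𝒢.Adelic)} : Set 𝒢.Adelic)))
    [∀ c, IsHaarMeasure (νC c)] [∀ c, (νC c).IsMulRightInvariant] [∀ c, (νC c).IsInvInvariant] [∀ c, SFinite (νC c)]
    (hρH : ∀ c, ρH c = ρ.comap (Subgroup.inclusion inf_le_left))
    (hρF : ∀ c, ρF c = Measure.map (Subgroup.subgroupOfEquivOfLe inf_le_right).symm (ρH c)) :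
    ∃ κ : ℝ≥0, 0 < κ ∧
      (∀ c : ConjClasses 𝒢.arithmeticSubgroup,
        unfoldingConstant 𝒢.quotientSubgroup ρ μ ν *
            quotientMeasure ((𝒢.quotientSubgroup ⊓ Subgroup.centralizer
              ({((Quotient.out c : 𝒢.arithmeticSubgroup) : 𝒢.Adelic)} : Set 𝒢.Adelic)).subgroupOf
              (Subgroup.centralizer ({((Quotient.out c : 𝒢.arithmeticSubgroup) : 𝒢.Adelic)} : Set 𝒢.Adelic)))
              (ρF c) (isClosed_subgroupOf _ _ (hH.inter (hCcl _))) (νC c) Set.univ ≠ 0 ∧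
          unfoldingConstant 𝒢.quotientSubgroup ρ μ ν *
            quotientMeasure ((𝒢.quotientSubgroup ⊓ Subgroup.centralizer
              ({((Quotient.out c : 𝒢.arithmeticSubgroup) : 𝒢.Adelic)} : Set 𝒢.Adelic)).subgroupOf
              (Subgroup.centralizer ({((Quotient.out c : 𝒢.arithmeticSubgroup) : 𝒢.Adelic)} : Set 𝒢.Adelic)))
              (ρF c) (isClosed_subgroupOf _ _ (hH.inter (hCcl _))) (νC c) Set.univ ≠ ∞) ∧
      ∀ Φ : C_c(𝒢.Adelic, ℂ),
        (∀ c, Integrable (descConj ((Quotient.out c : 𝒢.arithmeticSubgroup) : 𝒢.Adelic)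
          (Subgroup.centralizer ({((Quotient.out c : 𝒢.arithmeticSubgroup) : 𝒢.Adelic)} : Set 𝒢.Adelic))
          (fun _ hg => Subgroup.mem_centralizer_singleton_iff.1 hg) Φ)
          (quotientMeasure (Subgroup.centralizer
            ({((Quotient.out c : 𝒢.arithmeticSubgroup) : 𝒢.Adelic)} : Set 𝒢.Adelic)) (νC c) (hCcl _) ν)) ∧
        Summable (fun c => (unfoldingConstant 𝒢.quotientSubgroup ρ μ ν *
            quotientMeasure ((𝒢.quotientSubgroup ⊓ Subgroup.centralizer
              ({((Quotient.out c : 𝒢.arithmeticSubgroup) : 𝒢.Adelic)} : Set 𝒢.Adelic)).subgroupOf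
              (Subgroup.centralizer ({((Quotient.out c : 𝒢.arithmeticSubgroup) : 𝒢.Adelic)} : Set 𝒢.Adelic)))
              (ρF c) (isClosed_subgroupOf _ _ (hH.inter (hCcl _))) (νC c) Set.univ).toReal *
          ∫ y, ‖descConj ((Quotient.out c : 𝒢.arithmeticSubgroup) : 𝒢.Adelic)
            (Subgroup.centralizer ({((Quotient.out c : 𝒢.arithmeticSubgroup) : 𝒢.Adelic)} : Set 𝒢.Adelic))
            (fun _ hg => Subgroup.mem_centralizer_singleton_iff.1 hg) Φ y‖
              ∂(quotientMeasure (Subgroup.centralizer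
                ({((Quotient.out c : 𝒢.arithmeticSubgroup) : 𝒢.Adelic)} : Set 𝒢.Adelic)) (νC c) (hCcl _) ν)) ∧
        ∫ x, quotientKernel 𝒢.quotientSubgroup ρ Φ x x ∂μ =
          ((κ : ℝ) : ℂ) * ∑' c, (((unfoldingConstant 𝒢.quotientSubgroup ρ μ ν *
            quotientMeasure ((𝒢.quotientSubgroup ⊓ Subgroup.centralizer
              ({((Quotient.out c : 𝒢.arithmeticSubgroup) : 𝒢.Adelic)} : Set 𝒢.Adelic)).subgroupOf
              (Subgroup.centralizer ({((Quotient.out c : 𝒢.arithmeticSubgroup) : 𝒢.Adelic)} : Set 𝒢.Adelic)))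
              (ρF c) (isClosed_subgroupOf _ _ (hH.inter (hCcl _))) (νC c) Set.univ).toReal : ℝ) : ℂ) *
            ∫ y, descConj ((Quotient.out c : 𝒢.arithmeticSubgroup) : 𝒢.Adelic)
              (Subgroup.centralizer ({((Quotient.out c : 𝒢.arithmeticSubgroup) : 𝒢.Adelic)} : Set 𝒢.Adelic))
              (fun _ hg => Subgroup.mem_centralizer_singleton_iff.1 hg) Φ y
                ∂(quotientMeasure (Subgroup.centralizer
                  ({((Quotient.out c : 𝒢.arithmeticSubgroup) : 𝒢.Adelic)} : Set 𝒢.Adelic)) (νC c) (hCcl _) ν) := by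
  classical
  haveI : DiscreteTopology 𝒢.arithmeticSubgroup := hdisc
  haveI : Countable 𝒢.arithmeticSubgroup := DiscreteSubgroup.countable_of_discrete _
  obtain ⟨hθc, hθA, hθa, hθγ⟩ := 𝒢.centralRetraction_one' hc
  have hρ0 : ρ ≠ 0 := fun h => by
    have h2 : 0 < ρ Set.univ := isOpen_univ.measure_pos ρ ⟨1, trivial⟩
    rw [h] at h2
    exact lt_irrefl _ h2
  -- `A_G = 1`: a point; its probability Haar measure `α`, for which `Φ_A = Φ`
  have hsub : ∀ a : 𝒢.center', (a : 𝒢.Adelic) = 1 := fun a =>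
    Subgroup.mem_bot.1 (by rw [← hc]; exact a.2)
  haveI : Subsingleton 𝒢.center' := ⟨fun a b => Subtype.ext ((hsub a).trans (hsub b).symm)⟩
  haveI : CompactSpace 𝒢.center' := Finite.compactSpace
  have hAc : IsClosed (𝒢.center' : Set 𝒢.Adelic) := by
    rw [hc, Subgroup.coe_bot]
    exact isClosed_singleton
  haveI : LocallyCompactSpace 𝒢.center' := hAc.isClosedEmbedding_subtypeVal.locallyCompactSpace
  obtain ⟨α, hαH, hα1⟩ : ∃ α : Measure 𝒢.center', α.IsHaarMeasure ∧ α Set.univ = 1 := by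
    have h0 : (haar : Measure 𝒢.center') Set.univ ≠ 0 :=
      (isOpen_univ.measure_pos haar ⟨1, trivial⟩).ne'
    have htop : (haar : Measure 𝒢.center') Set.univ ≠ ∞ :=
      (isCompact_univ.measure_lt_top (μ := (haar : Measure 𝒢.center'))).ne
    refine ⟨((haar : Measure 𝒢.center') Set.univ)⁻¹ • haar,
      IsHaarMeasure.smul (haar : Measure 𝒢.center') (ENNReal.inv_ne_zero.2 htop)
        (ENNReal.inv_ne_top.2 h0), ?_⟩
    rw [Measure.smul_apply, smul_eq_mul, ENNReal.inv_mul_cancel h0 htop]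
  haveI := hαH
  haveI : IsFiniteMeasure α := ⟨by rw [hα1]; exact ENNReal.one_lt_top⟩
  have hΦA : ∀ Φ : C_c(𝒢.Adelic, ℂ), (fun g => ∫ a, Φ ((a : 𝒢.Adelic)⁻¹ * g) ∂α) = ⇑Φ := by
    intro Φ
    funext g
    have h1 : (fun a : 𝒢.center' => Φ ((a : 𝒢.Adelic)⁻¹ * g)) = fun _ => Φ g := by
      funext a
      rw [hsub a, inv_one, one_mul]
    rw [h1, integral_const]
    simp [measureReal_def, hα1]
  -- `ρ = κ • (α ⊗ counting)`
  obtain ⟨κ, hκpos, hκ⟩ := exists_eq_smul_map_mul_prod_count 𝒢 hdisc 1 hθc hθA hθa hθγ α ρ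
  -- the explicit constants lie in `(0, ∞)`
  have hrep : ∀ c : ConjClasses 𝒢.arithmeticSubgroup,
      ConjClasses.mk (Quotient.out c : 𝒢.arithmeticSubgroup) = c := fun c => by
    rw [← ConjClasses.quotient_mk_eq_mk]; exact Quotient.out_eq c
  haveI : ∀ c : ConjClasses 𝒢.arithmeticSubgroup,
      IsClosed (((𝒢.quotientSubgroup ⊓ Subgroup.centralizer
        ({((Quotient.out c : 𝒢.arithmeticSubgroup) : 𝒢.Adelic)} : Set 𝒢.Adelic)) : Subgroup 𝒢.Adelic) :
          Set 𝒢.Adelic) := fun c => hH.inter (hCcl _)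
  haveI : ∀ c : ConjClasses 𝒢.arithmeticSubgroup,
      CompactSpace (↥(Subgroup.centralizer ({((Quotient.out c : 𝒢.arithmeticSubgroup) : 𝒢.Adelic)} : Set 𝒢.Adelic)) ⧸
        (𝒢.quotientSubgroup ⊓ Subgroup.centralizer ({((Quotient.out c : 𝒢.arithmeticSubgroup) : 𝒢.Adelic)} :
          Set 𝒢.Adelic)).subgroupOf (Subgroup.centralizer
            ({((Quotient.out c : 𝒢.arithmeticSubgroup) : 𝒢.Adelic)} : Set 𝒢.Adelic))) :=
    fun c => 𝒢.compactSpace_centralizer_quotient hdisc (Quotient.out c).2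
  have hcμ : (unfoldingConstant 𝒢.quotientSubgroup ρ μ ν : ℝ≥0∞) ≠ 0 :=
    ENNReal.coe_ne_zero.2 (unfoldingConstant_pos 𝒢.quotientSubgroup ρ μ ν (AdelicGroupData.IsAutomorphicMeasure.ne_zero 𝒢 μ) hρ0).ne'
  have hd : ∀ c : ConjClasses 𝒢.arithmeticSubgroup,
      unfoldingConstant 𝒢.quotientSubgroup ρ μ ν *
          quotientMeasure ((𝒢.quotientSubgroup ⊓ Subgroup.centralizer
            ({((Quotient.out c : 𝒢.arithmeticSubgroup) : 𝒢.Adelic)} : Set 𝒢.Adelic)).subgroupOf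
            (Subgroup.centralizer ({((Quotient.out c : 𝒢.arithmeticSubgroup) : 𝒢.Adelic)} : Set 𝒢.Adelic)))
            (ρF c) (isClosed_subgroupOf _ _ (hH.inter (hCcl _))) (νC c) Set.univ ≠ 0 ∧
        unfoldingConstant 𝒢.quotientSubgroup ρ μ ν *
          quotientMeasure ((𝒢.quotientSubgroup ⊓ Subgroup.centralizer
            ({((Quotient.out c : 𝒢.arithmeticSubgroup) : 𝒢.Adelic)} : Set 𝒢.Adelic)).subgroupOf
            (Subgroup.centralizer ({((Quotient.out c : 𝒢.arithmeticSubgroup) : 𝒢.Adelic)} : Set 𝒢.Adelic)))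
            (ρF c) (isClosed_subgroupOf _ _ (hH.inter (hCcl _))) (νC c) Set.univ ≠ ∞ := fun c => by
    have h0 := Measure.measure_univ_ne_zero.2 (quotientMeasure_ne_zero
      (((𝒢.quotientSubgroup ⊓ Subgroup.centralizer
        ({((Quotient.out c : 𝒢.arithmeticSubgroup) : 𝒢.Adelic)} : Set 𝒢.Adelic)).subgroupOf
        (Subgroup.centralizer ({((Quotient.out c : 𝒢.arithmeticSubgroup) : 𝒢.Adelic)} : Set 𝒢.Adelic))))
      (ρF c) (isClosed_subgroupOf _ _ (hH.inter (hCcl _))) (νC c))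
    have ht := (isCompact_univ.measure_lt_top (μ := quotientMeasure
      (((𝒢.quotientSubgroup ⊓ Subgroup.centralizer
        ({((Quotient.out c : 𝒢.arithmeticSubgroup) : 𝒢.Adelic)} : Set 𝒢.Adelic)).subgroupOf
        (Subgroup.centralizer ({((Quotient.out c : 𝒢.arithmeticSubgroup) : 𝒢.Adelic)} : Set 𝒢.Adelic))))
      (ρF c) (isClosed_subgroupOf _ _ (hH.inter (hCcl _))) (νC c))).ne
    exact ⟨mul_ne_zero hcμ h0, ENNReal.mul_ne_top ENNReal.coe_ne_top ht⟩
  -- the `[0, ∞]`-valued identity feeds the `ℂ`-valued assembly of the tree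
  have hId := fun (F : 𝒢.Adelic → ℝ≥0∞) (hF : Measurable F) =>
    𝒢.lintegral_conjTsum_eq_mul_tsum_covol_mul_of_center'_eq_bot hc hdisc μ ν ρ ρH ρF νC hρH hρF hF
  refine ⟨κ, hκpos, hd, fun Φ => ?_⟩
  obtain ⟨hInt, hSum, hEq⟩ := integral_quotientKernel_diag_eq_mul_tsum 𝒢 hdisc 1 hθc hθA hθa hθγ α ρ hκ
    (fun c => Quotient.out c)
    (fun c => Subgroup.centralizer ({((Quotient.out c : 𝒢.arithmeticSubgroup) : 𝒢.Adelic)} : Set 𝒢.Adelic))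
    (fun c => fun _ hg => Subgroup.mem_centralizer_singleton_iff.1 hg) μ
    (fun c => quotientMeasure (Subgroup.centralizer
      ({((Quotient.out c : 𝒢.arithmeticSubgroup) : 𝒢.Adelic)} : Set 𝒢.Adelic)) (νC c) (hCcl _) ν) hρ0
    (fun c => (hd c).1) (fun F hF => by rw [hId F hF, ← ENNReal.tsum_mul_left]; exact tsum_congr fun c => by rw [mul_assoc])
    Φ
  have hdesc : ∀ c : ConjClasses 𝒢.arithmeticSubgroup,
      descConj ((Quotient.out c : 𝒢.arithmeticSubgroup) : 𝒢.Adelic)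
        (Subgroup.centralizer ({((Quotient.out c : 𝒢.arithmeticSubgroup) : 𝒢.Adelic)} : Set 𝒢.Adelic))
        (fun _ hg => Subgroup.mem_centralizer_singleton_iff.1 hg) (fun g => ∫ a, Φ ((a : 𝒢.Adelic)⁻¹ * g) ∂α) =
      descConj ((Quotient.out c : 𝒢.arithmeticSubgroup) : 𝒢.Adelic)
        (Subgroup.centralizer ({((Quotient.out c : 𝒢.arithmeticSubgroup) : 𝒢.Adelic)} : Set 𝒢.Adelic))
        (fun _ hg => Subgroup.mem_centralizer_singleton_iff.1 hg) ⇑Φ := fun c =>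
    congrArg (descConj ((Quotient.out c : 𝒢.arithmeticSubgroup) : 𝒢.Adelic)
      (Subgroup.centralizer ({((Quotient.out c : 𝒢.arithmeticSubgroup) : 𝒢.Adelic)} : Set 𝒢.Adelic))
      (fun _ hg => Subgroup.mem_centralizer_singleton_iff.1 hg)) (hΦA Φ)
  simp only [hdesc] at hInt hSum hEq
  exact ⟨hInt, hSum, hEq⟩

end AdelicGroupData

/-! ## The anisotropic unitary group `U(H)(𝔸_{L⁺})` -/

namespace UnitaryGroup

open Literature.AlgebraicGeometry.ShimuraVarieties (hermForm)

variable (L : Type) [Field L] [NumberField L] [IsCMField L] (N : ℕ) (H : Matrix (Fin N) (Fin N) L)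
  [MeasurableSpace (cmDatum L N H).Adelic] [BorelSpace (cmDatum L N H).Adelic]
  [∀ γ : (cmDatum L N H).Adelic, MeasurableSpace ((cmDatum L N H).Adelic ⧸
    Subgroup.centralizer ({γ} : Set (cmDatum L N H).Adelic))]
  [∀ γ : (cmDatum L N H).Adelic, BorelSpace ((cmDatum L N H).Adelic ⧸
    Subgroup.centralizer ({γ} : Set (cmDatum L N H).Adelic))]
  [∀ γ : (cmDatum L N H).Adelic, MeasurableSpace (↥(Subgroup.centralizer ({γ} : Set (cmDatum L N H).Adelic)) ⧸
    ((cmDatum L N H).quotientSubgroup ⊓ Subgroup.centralizer ({γ} : Set (cmDatum L N H).Adelic)).subgroupOf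
      (Subgroup.centralizer ({γ} : Set (cmDatum L N H).Adelic)))]
  [∀ γ : (cmDatum L N H).Adelic, BorelSpace (↥(Subgroup.centralizer ({γ} : Set (cmDatum L N H).Adelic)) ⧸
    ((cmDatum L N H).quotientSubgroup ⊓ Subgroup.centralizer ({γ} : Set (cmDatum L N H).Adelic)).subgroupOf
      (Subgroup.centralizer ({γ} : Set (cmDatum L N H).Adelic)))]

attribute [local instance] AdelicGroupData.measurableSpaceQuotientForm
  AdelicGroupData.borelSpaceQuotientForm AdelicGroupData.smulInvariantMeasureQuotientForm
  AdelicGroupData.isFiniteMeasureOnCompactsQuotientForm AdelicGroupData.isFiniteMeasureQuotientForm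

/-- **The geometric side for `U(H)`, `H` anisotropic, with the printed volumes** (Rogawski (1990), §14.5 pp. 237–238 (print):
`J_{G′}(f′) = Σ_γ a_γ Φ(γ, f′)` with `a_γ` a covolume of `G′_γ`; Gelbart (1975), Remark 9.23): for `H` anisotropic (compact
automorphic quotient by Godement), `μ` automorphic, Haar measures `ν` on `U(H)(𝔸_{L⁺})` and `ρ` on the discrete `U(H)(L⁺)` (right
invariant and s-finite: the binders of the kernel), and a Haar measure `ν_c` on EACH adelic centraliser `U(H)(𝔸)_{γ_c}` (two-sided and inversion
invariant: automatic, ★ `isMulRightInvariant_centralizer_cmDatum` ∕ `AdelicGroupData.isInvInvariant_centralizer_of_center'_eq_bot`), with the restricted measures `ρ_{H,c} = ρ|_{U(H)(L⁺)_{γ_c}}`,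
`ρ_{F,c}` (`AdelicGroupData.exists_restricted_haar_of_center'_eq_bot`): there is `κ > 0` with, for every `Φ ∈ C_c(U(H)(𝔸))`,
absolutely convergent orbital integrals and

  `∫_X K_Φ(x, x) dμ = κ · Σ'_c (c_μ · vol(U(H)(𝔸)_{γ_c} ⧸ U(H)(L⁺)_{γ_c})) · ∫ Φ(y γ_c y⁻¹) d(ν/ν_c)(y)`.

[cite: Rogawski1990, §14.5 pp. 237–238] -/
theorem integral_quotientKernel_diag_eq_mul_tsum_covol_cmDatum
    (hanis : ∀ x : Fin N → L, hermForm (cmConjRingHom L) H x x = 0 → x = 0)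
    [hH : IsClosed ((cmDatum L N H).quotientSubgroup : Set (cmDatum L N H).Adelic)]
    [hCcl : ∀ γ : (cmDatum L N H).Adelic, IsClosed ((Subgroup.centralizer ({γ} : Set (cmDatum L N H).Adelic) :
      Subgroup (cmDatum L N H).Adelic) : Set (cmDatum L N H).Adelic)]
    (μ : Measure (cmDatum L N H).automorphicQuotient) [(cmDatum L N H).IsAutomorphicMeasure μ]
    (ν : Measure (cmDatum L N H).Adelic) [IsHaarMeasure ν] [ν.IsMulRightInvariant]
    (ρ : Measure (cmDatum L N H).quotientSubgroup) [ρ.IsHaarMeasure] [ρ.IsMulRightInvariant] [SFinite ρ]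
    (ρH : ∀ c : ConjClasses (cmDatum L N H).arithmeticSubgroup, Measure ↥((cmDatum L N H).quotientSubgroup ⊓
      Subgroup.centralizer ({((Quotient.out c : (cmDatum L N H).arithmeticSubgroup) : (cmDatum L N H).Adelic)} :
        Set (cmDatum L N H).Adelic)))
    [∀ c, IsHaarMeasure (ρH c)] [∀ c, (ρH c).IsInvInvariant] [∀ c, SFinite (ρH c)]
    (ρF : ∀ c : ConjClasses (cmDatum L N H).arithmeticSubgroup, Measure ↥(((cmDatum L N H).quotientSubgroup ⊓
      Subgroup.centralizer ({((Quotient.out c : (cmDatum L N H).arithmeticSubgroup) : (cmDatum L N H).Adelic)} :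
        Set (cmDatum L N H).Adelic)).subgroupOf (Subgroup.centralizer
          ({((Quotient.out c : (cmDatum L N H).arithmeticSubgroup) : (cmDatum L N H).Adelic)} : Set (cmDatum L N H).Adelic))))
    [∀ c, IsHaarMeasure (ρF c)] [∀ c, (ρF c).IsInvInvariant] [∀ c, SFinite (ρF c)]
    (νC : ∀ c : ConjClasses (cmDatum L N H).arithmeticSubgroup, Measure ↥(Subgroup.centralizer
      ({((Quotient.out c : (cmDatum L N H).arithmeticSubgroup) : (cmDatum L N H).Adelic)} : Set (cmDatum L N H).Adelic)))
    [∀ c, IsHaarMeasure (νC c)] [∀ c, (νC c).IsMulRightInvariant] [∀ c, (νC c).IsInvInvariant] [∀ c, SFinite (νC c)]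
    (hρH : ∀ c, ρH c = ρ.comap (Subgroup.inclusion inf_le_left))
    (hρF : ∀ c, ρF c = Measure.map (Subgroup.subgroupOfEquivOfLe inf_le_right).symm (ρH c)) :
    ∃ κ : ℝ≥0, 0 < κ ∧
      (∀ c : ConjClasses (cmDatum L N H).arithmeticSubgroup,
        unfoldingConstant (cmDatum L N H).quotientSubgroup ρ μ ν *
            quotientMeasure (((cmDatum L N H).quotientSubgroup ⊓ Subgroup.centralizer
              ({((Quotient.out c : (cmDatum L N H).arithmeticSubgroup) : (cmDatum L N H).Adelic)} :
                Set (cmDatum L N H).Adelic)).subgroupOf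
              (Subgroup.centralizer ({((Quotient.out c : (cmDatum L N H).arithmeticSubgroup) : (cmDatum L N H).Adelic)} :
                Set (cmDatum L N H).Adelic)))
              (ρF c) (isClosed_subgroupOf _ _ (hH.inter (hCcl _))) (νC c) Set.univ ≠ 0 ∧
          unfoldingConstant (cmDatum L N H).quotientSubgroup ρ μ ν *
            quotientMeasure (((cmDatum L N H).quotientSubgroup ⊓ Subgroup.centralizer
              ({((Quotient.out c : (cmDatum L N H).arithmeticSubgroup) : (cmDatum L N H).Adelic)} :
                Set (cmDatum L N H).Adelic)).subgroupOf
              (Subgroup.centralizer ({((Quotient.out c : (cmDatum L N H).arithmeticSubgroup) : (cmDatum L N H).Adelic)} :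
                Set (cmDatum L N H).Adelic)))
              (ρF c) (isClosed_subgroupOf _ _ (hH.inter (hCcl _))) (νC c) Set.univ ≠ ∞) ∧
      ∀ Φ : C_c((cmDatum L N H).Adelic, ℂ),
        (∀ c, Integrable (descConj ((Quotient.out c : (cmDatum L N H).arithmeticSubgroup) : (cmDatum L N H).Adelic)
          (Subgroup.centralizer ({((Quotient.out c : (cmDatum L N H).arithmeticSubgroup) : (cmDatum L N H).Adelic)} :
            Set (cmDatum L N H).Adelic))
          (fun _ hg => Subgroup.mem_centralizer_singleton_iff.1 hg) Φ)
          (quotientMeasure (Subgroup.centralizer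
            ({((Quotient.out c : (cmDatum L N H).arithmeticSubgroup) : (cmDatum L N H).Adelic)} :
              Set (cmDatum L N H).Adelic)) (νC c) (hCcl _) ν)) ∧
        Summable (fun c => (unfoldingConstant (cmDatum L N H).quotientSubgroup ρ μ ν *
            quotientMeasure (((cmDatum L N H).quotientSubgroup ⊓ Subgroup.centralizer
              ({((Quotient.out c : (cmDatum L N H).arithmeticSubgroup) : (cmDatum L N H).Adelic)} :
                Set (cmDatum L N H).Adelic)).subgroupOf
              (Subgroup.centralizer ({((Quotient.out c : (cmDatum L N H).arithmeticSubgroup) : (cmDatum L N H).Adelic)} :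
                Set (cmDatum L N H).Adelic)))
              (ρF c) (isClosed_subgroupOf _ _ (hH.inter (hCcl _))) (νC c) Set.univ).toReal *
          ∫ y, ‖descConj ((Quotient.out c : (cmDatum L N H).arithmeticSubgroup) : (cmDatum L N H).Adelic)
            (Subgroup.centralizer ({((Quotient.out c : (cmDatum L N H).arithmeticSubgroup) : (cmDatum L N H).Adelic)} :
              Set (cmDatum L N H).Adelic))
            (fun _ hg => Subgroup.mem_centralizer_singleton_iff.1 hg) Φ y‖
              ∂(quotientMeasure (Subgroup.centralizer
                ({((Quotient.out c : (cmDatum L N H).arithmeticSubgroup) : (cmDatum L N H).Adelic)} :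
                  Set (cmDatum L N H).Adelic)) (νC c) (hCcl _) ν)) ∧
        ∫ x, quotientKernel (cmDatum L N H).quotientSubgroup ρ Φ x x ∂μ =
          ((κ : ℝ) : ℂ) * ∑' c, (((unfoldingConstant (cmDatum L N H).quotientSubgroup ρ μ ν *
            quotientMeasure (((cmDatum L N H).quotientSubgroup ⊓ Subgroup.centralizer
              ({((Quotient.out c : (cmDatum L N H).arithmeticSubgroup) : (cmDatum L N H).Adelic)} :
                Set (cmDatum L N H).Adelic)).subgroupOf
              (Subgroup.centralizer ({((Quotient.out c : (cmDatum L N H).arithmeticSubgroup) : (cmDatum L N H).Adelic)} :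
                Set (cmDatum L N H).Adelic)))
              (ρF c) (isClosed_subgroupOf _ _ (hH.inter (hCcl _))) (νC c) Set.univ).toReal : ℝ) : ℂ) *
            ∫ y, descConj ((Quotient.out c : (cmDatum L N H).arithmeticSubgroup) : (cmDatum L N H).Adelic)
              (Subgroup.centralizer ({((Quotient.out c : (cmDatum L N H).arithmeticSubgroup) : (cmDatum L N H).Adelic)} :
                Set (cmDatum L N H).Adelic))
              (fun _ hg => Subgroup.mem_centralizer_singleton_iff.1 hg) Φ y
                ∂(quotientMeasure (Subgroup.centralizer
                  ({((Quotient.out c : (cmDatum L N H).arithmeticSubgroup) : (cmDatum L N H).Adelic)} :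
                    Set (cmDatum L N H).Adelic)) (νC c) (hCcl _) ν) := by
  haveI := compactSpace_cmDatum_automorphicQuotient L N H hanis
  exact (cmDatum L N H).integral_quotientKernel_diag_eq_mul_tsum_covol_of_center'_eq_bot
    (cmDatum_center' L N H) (cmDatum_isDiscreteRational L N H) μ ν ρ ρH ρF νC hρH hρF

end UnitaryGroup

end Literature.NumberTheory.Automorphic
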